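import Summits.BirchSwinnertonDyer.Rank1Residual.Additive.KatoDescentIntegralH1Index
import HarnessLib

set_option autoImplicit false

/-!
# The display COUNT (7) of stub 3 `stub_rankOneCountReadingKato` REDUCED to its `x`-free, `s`-free core COUNT-EC — the
# rank-one Euler-characteristic identity for (`H¹(ℤ[1/p], T_pW)`, `𝐇²_Γ`) — modulo GZK and Kato Thm. 12.4 (2); stub 3 of the
# Kato–Perrin-Riou skeletons v4 from {GZK, `IsNewformOf.level_eq_conductorNorm`, `Kato2004.thm12_4`} + {PR-INV, COUNT-EC}
# (seat `bsd-cm-prr-ty1` g9, cell `bsd-cm`; theorems only: no definition, no named fact, no instance, no `sorry`)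

Part 10 of the seat's kernel cut of stub 3 (cruxes stmt-BirchSwinnertonDyer-19945 `…/Lines/kato_perrin_riou_zp.lean`,
stmt-BirchSwinnertonDyer-19223 `…/Lines/kato_perrin_riou_istar.lean`; = cell bsd-potss's held input 27322). The display
COUNT (7) of `KatoDescentRankOneCountContraOfFacts.lean` (hypothesis `hCount` of every reduction since g7) reads, on the rows,
for a package `J` with the (H2ᶜ) lengths pin, `x ∈ 𝐇¹_Γ`, `s` a Kummer logarithm of `proj₀ x`, `P` a generator of `W(ℚ)/tors`:
(ii) `s ≠ 0 ↔ [J.A : Λ·J.ι[x]] ≠ 0` and (iii) `[J.A : Λ·J.ι[x]] = p^m·#𝐇²_Γ/T ⇒ v_p s = m + v_p #Ш[p^∞] + v_p Tam + 2 v_p log_ω P`.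
Part 9 (`KatoDescentIntegralH1Index.lean`) PROVED (ii) on every package over a pin with `𝐇¹_Γ` f.g. torsion-free `≠ 0` and
computed the index: `[J.A : Λ·J.ι[x]] = #ker φ · p^{v(s) − v₀}` for the Kummer-logarithm functional `φ` (`φ(A) = p^{v₀}ℤ_p`,
`ker φ = A_tors`). Substituting, (iii) becomes INDEPENDENT of `x` and `s`:

**COUNT-EC** (displayed here; hypothesis `hEC`): on the rows of the reading (`r_an = 1`, `p ≠ 2` additive potentially good,
`p ∤ #tors`, `Ш` finite), for `κ` cyclotomic with topological generator `γ`, a pin `I`, a package `J` with the (H2ᶜ) lengths pin,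
a generator `P` of `W(ℚ)/tors`, and the Kummer-log functional `φ` on `A = H¹(ℤ[1/p], T_pW)` with `φ(A) = p^{v₀}ℤ_p`:
`v_p #(𝐇²_Γ/T) + v₀ − v_p #ker φ = v_p #Ш[p^∞] + v_p Tam(W) + 2·v_p log_ω(P)`.
PRINT (cell bsd-potss's memo KMC-DESCENT-MEMO §4 (R1-a)–(R1-f), assembled): `A = 𝔥 = p^a ℤ_p κ(P)` torsion-free (`p ∤ #tors`),
so `ker φ = 0` and `v₀ = a + v_p log_ω P` (`φ = log_ω ∘ loc_p`, Bloch–Kato 3.11); `#𝐇²_Γ/T = #H²(ℤ[1/p], T_pW)` ((14.14.2) with the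
(H2ᶜ) pin and the `T`-Euler characteristic) `= p^t · p^e · #Ш[p^∞] · ∏_{ℓ≠p} c_ℓ^{(p)} / p^a` (Kato (14.9.3) + Poitou–Tate for the Selmer
structures Kummer ⊂ unramified-at-ℓ≠p, Greenberg §3 `#H¹_ur(ℚ_ℓ, E[p^∞]) = c_ℓ^{(p)}`, Cassels); `v_p log_ω P = e + t − v_p c_p`
(Kim §3.2.3 / the tree's `LocalIndex.range_eq_span_zpow_of_filtration`); whence both sides equal `t + e + v_p#Ш + Σ_{ℓ≠p} v_p c_ℓ +
v_p log_ω P`. SIZE of COUNT-EC as a kernel target: XL (compact Poitou–Tate count for `T_pE` over `ℚ` with all local terms).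

* `count_of_gzk_of_thm12_4_of_countEC hGZK h12 hEC : <hCount verbatim>` — COUNT from GZK (`rank = 1` on the rows, for the
  functional's existence and non-vanishing), `Kato2004.thm12_4` ((12.2.1) + 12.4 (2) on the pin: `𝐇¹_Γ` f.g. torsion-free of
  rank one — the COUNT display quantifies over arbitrary pins, which carry no such data) and COUNT-EC; conjunct (ii) by part 9,
  conjunct (iii) by the index formula and `p`-adic valuation bookkeeping.
* `rankOneCountReading_contra_of_gzk_of_thm12_4_of_countEC hGZK hlev h12 hPRinv hEC` = THE WHOLE STUB (verbatim type) from
  THREE named facts {GZK, `IsNewformOf.level_eq_conductorNorm`, `Kato2004.thm12_4`} + TWO displays {PR-INV (6), COUNT-EC}.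
  (`Kato2004.thm12_4` is already owed by stub 4 of the same skeletons — `ContraRealizable.realizableOfKMC_contra_of_thm12_4_…`.)

HONEST LABEL: conditional reductions on displayed hypotheses; no stub or item is closed; nothing is registered; nothing is
asserted on 19945 / 19223; Kato's Main Conjecture and Perrin-Riou's conjecture are not touched; BSD is not proved for any curve.

References: [Kato2004Asterisque] §14.9 (14.9.3) (p. 240), §14.14 (14.14.1)–(14.14.2) (p. 243), Prop. 14.16 (p. 244), Thm. 12.4
(2) (p. 221); [BlochKato1990] Ex. 3.11; [GreenbergLNM1716] §3–4; [CoatesLNM1716] L. 3.6/3.8; [Kim2022StructureSelmer] §3.2.3;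
[BurnsKuriharaSano2019] Thm. 7.3 / 7.8 (d); [Darmon2004] Thm. 3.22.
-/

noncomputable section

open scoped Classical NumberField

open WeierstrassCurve Field IsDedekindDomain Literature.NumberTheory.EllipticCurves
  Literature.NumberTheory.EllipticCurves.Kato2004 Literature.NumberTheory.EllipticCurves.IwasawaAlgebra
  Literature.NumberTheory.EllipticCurves.Kato2004.EulerSystemValues Literature.NumberTheory.GaloisRepresentations
  Literature.NumberTheory.EllipticCurves.ModularForms Literature.NumberTheory.EllipticCurves.Rank1Residual
open Summit.BirchSwinnertonDyer.BirchSwinnertonDyer.Theorems.CongruentShaFreeCutKatoDescentDatumOfH2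

namespace Summit.BirchSwinnertonDyer.Rank1Residual.Additive.LocPKummer

/-! ## §1 COUNT (7) from GZK, Kato Thm. 12.4 (2) and the Euler-characteristic core COUNT-EC -/

/-- **COUNT ⟸ {GZK, `Kato2004.thm12_4`} + COUNT-EC.** The conclusion is VERBATIM the display `hCount` of
`ContraCount.rankOneCountReading_contra_of_facts` / `…_of_finite` / `LocPKummer.rankOneCountReading_contra_of_gzk`; the
hypothesis `hEC` is the `x`-free, `s`-free Euler-characteristic identity COUNT-EC (module docstring). Conjunct (ii) is part 9's
`count_ii_of_iwasawaH2Data`; conjunct (iii): `[J.A : Λ·J.ι[x]] = #ker φ · p^{v(s) − v₀}` (part 9) and `= p^m · #𝐇²_Γ/T` give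
`v_p #ker φ + v(s) − v₀ = m + v_p #𝐇²_Γ/T`, and COUNT-EC finishes. Conditional; nothing asserted.
[cite: Kato2004Asterisque, §14.9 (14.9.3) (p. 240), §14.14 (p. 243) and Prop. 14.16 (p. 244), Thm. 12.4 (2) (p. 221)]
[cite: BlochKato1990, Ex. 3.11] [cite: Darmon2004, Thm. 3.22] -/
theorem count_of_gzk_of_thm12_4_of_countEC
    (hGZK : rank_eq_analyticRank_of_analyticRank_le_one) (h12 : Kato2004.thm12_4)
    (hEC : ∀ (W : WeierstrassCurve ℚ) [W.IsElliptic] [W.IsGloballyMinimal] (p : ℕ) [Fact p.Prime],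
      letI : ContinuousSMul ℤ_[p] (W.tateModule p) := TateModule.continuousSMul_padicInt
      ∀ (κ : ZpExtension ℚ p) (γ : absoluteGaloisGroup ℚ), κ.IsCyclotomic → κ.IsTopGenerator γ →
        ∀ (I : IwasawaH1Data W p κ γ) (J : IwasawaH2Data W p κ γ I) (P : W.toAffine.Point)
          (φ : integralH1 (tateRep W p) p (κ.layerSubgroup 0) →ₗ[ℤ_[p]] ℚ_[p]) (v₀ : ℤ),
          W.analyticRank = 1 → p ≠ 2 → Addv W p → 0 ≤ padicValRat p W.j → ¬ p ∣ W.torsionOrder →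
          Finite W.sha →
          (∀ (Y : W.FineSelmerDualData κ γ⁻¹) (𝔮 : PrimeSpectrum (IwasawaAlgebra p)), 𝔮.asIdeal.height = 1 →
            Module.lengthAt (IwasawaAlgebra p) J.H2 𝔮 = Module.lengthAt (IwasawaAlgebra p) Y.X 𝔮) →
          (∀ Q : W.toAffine.Point, ∃ n : ℤ, IsOfFinAddOrder (Q - n • P)) →
          (∀ x : integralH1 (tateRep W p) p (κ.layerSubgroup 0),
            HasLocPKummerLog W p (layerZeroToTop W p κ (x : H1 (tateRep W p) (κ.layerSubgroup 0))) (φ x)) →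
          LinearMap.range φ = Submodule.span ℤ_[p] {((p : ℚ_[p]) ^ v₀)} →
          (padicValNat p (Nat.card (coinvariants p J.H2)) : ℤ) + v₀ - padicValNat p (Nat.card (LinearMap.ker φ)) =
            padicValNat p (Nat.card (AddCommGroup.primaryComponent W.sha p)) + padicValNat p W.tamagawaProduct +
              2 * (padicLogLocal W p
                (WeierstrassCurve.Affine.Point.map (W' := W.toAffine) (S := ℚ) (Algebra.ofId ℚ ℚ_[p]) P)).valuation) :
    ∀ (W : WeierstrassCurve ℚ) [W.IsElliptic] [W.IsGloballyMinimal] (p : ℕ) [Fact p.Prime],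
      letI : ContinuousSMul ℤ_[p] (W.tateModule p) := TateModule.continuousSMul_padicInt
      ∀ (κ : ZpExtension ℚ p) (γ : absoluteGaloisGroup ℚ), κ.IsCyclotomic → κ.IsTopGenerator γ →
        ∀ (I : IwasawaH1Data W p κ γ) (J : IwasawaH2Data W p κ γ I) (x : I.H) (s : ℚ_[p])
          (P : W.toAffine.Point),
          W.analyticRank = 1 → p ≠ 2 → Addv W p → 0 ≤ padicValRat p W.j → ¬ p ∣ W.torsionOrder →
          Finite W.sha →
          (∀ (Y : W.FineSelmerDualData κ γ⁻¹) (𝔮 : PrimeSpectrum (IwasawaAlgebra p)), 𝔮.asIdeal.height = 1 →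
            Module.lengthAt (IwasawaAlgebra p) J.H2 𝔮 = Module.lengthAt (IwasawaAlgebra p) Y.X 𝔮) →
          (∀ Q : W.toAffine.Point, ∃ n : ℤ, IsOfFinAddOrder (Q - n • P)) →
          HasLocPKummerLog W p (layerZeroToTop W p κ (I.proj 0 x)) s →
          (s ≠ 0 ↔ Nat.card (J.A ⧸ (IwasawaAlgebra p) ∙ J.ι (Submodule.Quotient.mk x)) ≠ 0) ∧
            ∀ m : ℕ, Nat.card (J.A ⧸ (IwasawaAlgebra p) ∙ J.ι (Submodule.Quotient.mk x)) =
                p ^ m * Nat.card (coinvariants p J.H2) →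
              s.valuation = (m : ℤ) + padicValNat p (Nat.card (AddCommGroup.primaryComponent W.sha p)) +
                padicValNat p W.tamagawaProduct +
                2 * (padicLogLocal W p
                  (WeierstrassCurve.Affine.Point.map (W' := W.toAffine) (S := ℚ) (Algebra.ofId ℚ ℚ_[p]) P)).valuation := by
  intro W _ _ p _
  letI : ContinuousSMul ℤ_[p] (W.tateModule p) := TateModule.continuousSMul_padicInt
  intro κ γ hκ hγ I J x s P hr hp2 hadd hj htors hsha hH2 hP hs
  have hp : p.Prime := Fact.out
  -- Gross–Zagier–Kolyvagin: rank one; `Ш[p^∞]` finite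
  obtain ⟨hmw, -⟩ := hGZK W (by rw [hr])
  have hrank : W.mordellWeilRank = 1 := by rw [hmw, hr]
  haveI := hsha
  have hsha' : Finite (AddCommGroup.primaryComponent W.sha p) := inferInstance
  -- Kato (12.2.1) + Thm. 12.4 (2) on the pin
  obtain ⟨hfg, ⟨htf, hrk⟩, -⟩ := h12 W p κ γ hκ hγ I
  haveI := hfg
  haveI := htf
  haveI : Nontrivial I.H := by
    by_contra hnt
    rw [not_nontrivial_iff_subsingleton] at hnt
    have h0 : Module.rank (IwasawaAlgebra p) I.H = 0 := rank_subsingleton' _ _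
    rw [hrk] at h0
    exact one_ne_zero h0
  -- the Kummer-logarithm functional and the index formula
  obtain ⟨φ, v₀, hφ, -, hfin, hφ0, hv₀⟩ := exists_kummerLog_range_eq W p J hrank hsha'
  haveI := hfin
  obtain ⟨ha, hb⟩ := natCard_quotient_ι_eq W p J φ hφ hφ0 hv₀ x hs
  refine ⟨count_ii_of_iwasawaH2Data W p J hrank hsha' x hs, fun m hm ↦ ?_⟩
  haveI := finite_coinvariants_H2_of_iwasawaH2Data W p J hrank hsha'
  have hcard_ne : Nat.card (J.A ⧸ (IwasawaAlgebra p) ∙ J.ι (Submodule.Quotient.mk x)) ≠ 0 := by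
    rw [hm]
    exact mul_ne_zero (pow_ne_zero _ hp.ne_zero) Nat.card_pos.ne'
  have hs0 : s ≠ 0 := fun h0 ↦ hcard_ne (hb h0)
  obtain ⟨hidx, hle⟩ := ha hs0
  have hec := hEC W p κ γ hκ hγ I J P φ v₀ hr hp2 hadd hj htors hsha hH2 hP hφ hv₀
  have hkey : Nat.card (LinearMap.ker φ) * p ^ (s.valuation - v₀).toNat =
      p ^ m * Nat.card (coinvariants p J.H2) := by rw [← hidx, hm]
  have hv := congrArg (padicValNat p) hkey
  rw [padicValNat.mul Nat.card_pos.ne' (pow_ne_zero _ hp.ne_zero), padicValNat.prime_pow,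
    padicValNat.mul (pow_ne_zero _ hp.ne_zero) Nat.card_pos.ne', padicValNat.prime_pow] at hv
  have hv' : (padicValNat p (Nat.card (LinearMap.ker φ)) : ℤ) + ((s.valuation - v₀).toNat : ℤ) =
      (m : ℤ) + padicValNat p (Nat.card (coinvariants p J.H2)) := by exact_mod_cast hv
  rw [Int.toNat_of_nonneg (sub_nonneg.mpr hle)] at hv'
  linarith

/-! ## §2 Stub 3 from THREE named facts and TWO displays {PR-INV, COUNT-EC} -/

/-- **STUB 3 `stub_rankOneCountReadingKato` from {GZK, `IsNewformOf.level_eq_conductorNorm`, `Kato2004.thm12_4`} + {PR-INV,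
COUNT-EC}**: `TorsionFree.RankOneCountReading IsKatoZetaDescentDatumOfContra Kato2004.PRRatio` (verbatim the stub's type in both v4
skeletons) — part 8's `rankOneCountReading_contra_of_gzk` with COUNT supplied by `count_of_gzk_of_thm12_4_of_countEC`.
Conditional reduction; closes nothing by itself.
[cite: Kato2004Asterisque, §13.9–13.12 (pp. 229–231), §14.9 (14.9.3) (p. 240), §14.14 (p. 243) and Prop. 14.16 (p. 244), Thm. 12.4 (2) (p. 221)]
[cite: BlochKato1990, Def. 3.10 and Ex. 3.11] [cite: BurnsKuriharaSano2019, Thm. 7.3 and Thm. 7.8 (d)] [cite: Darmon2004, Thm. 3.22] -/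
theorem rankOneCountReading_contra_of_gzk_of_thm12_4_of_countEC
    (hGZK : rank_eq_analyticRank_of_analyticRank_le_one)
    (hlev : ∀ (N : ℕ) [NeZero N], IsNewformOf.level_eq_conductorNorm (N := N))
    (h12 : Kato2004.thm12_4)
    (hPRinv : ∀ (W : WeierstrassCurve ℚ) [W.IsElliptic] [W.IsGloballyMinimal] (p : ℕ) [Fact p.Prime]
      (ℒ₁ ℒ₂ : ℚ_[p]), Kato2004.PRRatio W p ℒ₁ → Kato2004.PRRatio W p ℒ₂ → ∃ w : ℚ_[p], ‖w‖ = 1 ∧ ℒ₂ = w * ℒ₁)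
    (hEC : ∀ (W : WeierstrassCurve ℚ) [W.IsElliptic] [W.IsGloballyMinimal] (p : ℕ) [Fact p.Prime],
      letI : ContinuousSMul ℤ_[p] (W.tateModule p) := TateModule.continuousSMul_padicInt
      ∀ (κ : ZpExtension ℚ p) (γ : absoluteGaloisGroup ℚ), κ.IsCyclotomic → κ.IsTopGenerator γ →
        ∀ (I : IwasawaH1Data W p κ γ) (J : IwasawaH2Data W p κ γ I) (P : W.toAffine.Point)
          (φ : integralH1 (tateRep W p) p (κ.layerSubgroup 0) →ₗ[ℤ_[p]] ℚ_[p]) (v₀ : ℤ),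
          W.analyticRank = 1 → p ≠ 2 → Addv W p → 0 ≤ padicValRat p W.j → ¬ p ∣ W.torsionOrder →
          Finite W.sha →
          (∀ (Y : W.FineSelmerDualData κ γ⁻¹) (𝔮 : PrimeSpectrum (IwasawaAlgebra p)), 𝔮.asIdeal.height = 1 →
            Module.lengthAt (IwasawaAlgebra p) J.H2 𝔮 = Module.lengthAt (IwasawaAlgebra p) Y.X 𝔮) →
          (∀ Q : W.toAffine.Point, ∃ n : ℤ, IsOfFinAddOrder (Q - n • P)) →
          (∀ x : integralH1 (tateRep W p) p (κ.layerSubgroup 0),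
            HasLocPKummerLog W p (layerZeroToTop W p κ (x : H1 (tateRep W p) (κ.layerSubgroup 0))) (φ x)) →
          LinearMap.range φ = Submodule.span ℤ_[p] {((p : ℚ_[p]) ^ v₀)} →
          (padicValNat p (Nat.card (coinvariants p J.H2)) : ℤ) + v₀ - padicValNat p (Nat.card (LinearMap.ker φ)) =
            padicValNat p (Nat.card (AddCommGroup.primaryComponent W.sha p)) + padicValNat p W.tamagawaProduct +
              2 * (padicLogLocal W p
                (WeierstrassCurve.Affine.Point.map (W' := W.toAffine) (S := ℚ) (Algebra.ofId ℚ ℚ_[p]) P)).valuation) :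
    TorsionFree.RankOneCountReading IsKatoZetaDescentDatumOfContra Kato2004.PRRatio :=
  rankOneCountReading_contra_of_gzk hGZK hlev hPRinv (count_of_gzk_of_thm12_4_of_countEC hGZK h12 hEC)

end Summit.BirchSwinnertonDyer.Rank1Residual.Additive.LocPKummer

end
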